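import Literature.Geometry.Symplectic.PfaffianFour
import Mathlib.Analysis.InnerProductSpace.PiL2
import Mathlib.LinearAlgebra.Matrix.ToLinearEquiv
import Mathlib.Topology.Algebra.Module.Alternating.Basic

/-!
# Pfaffian identity `½ Ω ∧ Ω = Pf · det` on `ℝ⁴`, `Pf ≠ 0` for nondegenerate `Ω`, top forms on a hyperplane

Topic: Literature/Geometry/Symplectic.  Folklore multilinear algebra in dimension four,
complementing `PfaffianFour.lean` (where `Pf α = α(e₀,e₁) α(e₂,e₃) - α(e₀,e₂) α(e₁,e₃)
+ α(e₀,e₃) α(e₁,e₂)` is the Pfaffian of a 2-form `α` on `ℝ⁴` in the standard basis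
`eᵢ = EuclideanSpace.single i 1`):

* `pfaffian_identity_four` — the GENERAL Pfaffian identity
  `Ω(w₀,w₁) Ω(w₂,w₃) - Ω(w₀,w₂) Ω(w₁,w₃) + Ω(w₀,w₃) Ω(w₁,w₂) = Pf(Ω) · det (wᵢⱼ)`
  (`½ Ω ∧ Ω = Pf(Ω) dx₀₁₂₃`; a polynomial identity after the six-term expansion
  `alt_two_apply_eq` of each factor and the Laplace expansion `matrix_det_fin_four`);
* `pfaffian_ne_zero_of_nondegenerate_four` — a nondegenerate 2-form has `Pf ≠ 0`
  (the degeneracy criterion `pfaffian_eq_zero_iff`);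
* `alternating_three_eq_det_finCons` — HODGE DUALITY for 3-forms on `ℝ⁴`: an alternating
  trilinear form `R` is `R(a, b, c) = det[r, a, b, c]` for the vector
  `r = (R(e₁,e₂,e₃), -R(e₀,e₂,e₃), R(e₀,e₁,e₃), -R(e₀,e₁,e₂))`;
* `alternating_three_restrict_orthogonal_four` — restricted to triples orthogonal to a unit
  vector `u`, an alternating trilinear form is `κ · det[u, ·, ·, ·]` with `κ = ⟪r, u⟫`
  (the rows of `[r - κ u, v₀, v₁, v₂]` are all orthogonal to `u ≠ 0`, so its determinant
  vanishes), and `|κ| ≤ δ` whenever `|R(a,b,c)| ≤ δ ‖a‖ ‖b‖ ‖c‖` (evaluate on an orthonormal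
  frame `f` of `u^⊥`, for which `|det[u, f₀, f₁, f₂]| = 1` as the frame matrix `A` has
  `A Aᵀ = 1`).

All statements are elementary (folklore).
-/

noncomputable section

open scoped RealInnerProductSpace

namespace Literature.Geometry.Symplectic

/-! ### The Pfaffian identity and non-degeneracy -/

/-- **General Pfaffian identity** on `ℝ⁴` (`½ Ω ∧ Ω = Pf(Ω) · det`): for every 2-form `Ω` and
every quadruple of vectors `w`,
`Ω(w₀,w₁) Ω(w₂,w₃) - Ω(w₀,w₂) Ω(w₁,w₃) + Ω(w₀,w₃) Ω(w₁,w₂) = Pf(Ω) · det (wᵢⱼ)`, where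
`Pf(Ω) = Ω(e₀,e₁) Ω(e₂,e₃) - Ω(e₀,e₂) Ω(e₁,e₃) + Ω(e₀,e₃) Ω(e₁,e₂)`. [folklore] -/
theorem pfaffian_identity_four :
    ∀ (Ω : EuclideanSpace ℝ (Fin 4) [⋀^Fin 2]→L[ℝ] ℝ) (w : Fin 4 → EuclideanSpace ℝ (Fin 4)), Ω ![w 0, w 1] * Ω ![w 2, w 3] - Ω ![w 0, w 2] * Ω ![w 1, w 3] + Ω ![w 0, w 3] * Ω ![w 1, w 2] = (Ω ![EuclideanSpace.single 0 1, EuclideanSpace.single 1 1] * Ω ![EuclideanSpace.single 2 1, EuclideanSpace.single 3 1] - Ω ![EuclideanSpace.single 0 1, EuclideanSpace.single 2 1] * Ω ![EuclideanSpace.single 1 1, EuclideanSpace.single 3 1] + Ω ![EuclideanSpace.single 0 1, EuclideanSpace.single 3 1] * Ω ![EuclideanSpace.single 1 1, EuclideanSpace.single 2 1]) * (Matrix.of fun i j => w i j).det := by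
  intro Ω w
  have e : ∀ i : Fin 4, (EuclideanSpace.single i (1 : ℝ) : EuclideanSpace ℝ (Fin 4)) = stdVec i :=
    fun _ => rfl
  simp only [e]
  rw [matrix_det_fin_four, alt_two_apply_eq Ω (w 0) (w 1), alt_two_apply_eq Ω (w 2) (w 3),
    alt_two_apply_eq Ω (w 0) (w 2), alt_two_apply_eq Ω (w 1) (w 3),
    alt_two_apply_eq Ω (w 0) (w 3), alt_two_apply_eq Ω (w 1) (w 2)]
  simp only [Matrix.of_apply]
  ring

/-- A **nondegenerate** 2-form on `ℝ⁴` has non-zero Pfaffian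
`Ω(e₀,e₁) Ω(e₂,e₃) - Ω(e₀,e₂) Ω(e₁,e₃) + Ω(e₀,e₃) Ω(e₁,e₂) ≠ 0` (`det Ω = Pf(Ω)²`; the degeneracy
criterion `pfaffian_eq_zero_iff`). [folklore] -/
theorem pfaffian_ne_zero_of_nondegenerate_four :
    ∀ (Ω : EuclideanSpace ℝ (Fin 4) [⋀^Fin 2]→L[ℝ] ℝ), (∀ v : EuclideanSpace ℝ (Fin 4), v ≠ 0 → ∃ w, Ω ![v, w] ≠ 0) → Ω ![EuclideanSpace.single 0 1, EuclideanSpace.single 1 1] * Ω ![EuclideanSpace.single 2 1, EuclideanSpace.single 3 1] - Ω ![EuclideanSpace.single 0 1, EuclideanSpace.single 2 1] * Ω ![EuclideanSpace.single 1 1, EuclideanSpace.single 3 1] + Ω ![EuclideanSpace.single 0 1, EuclideanSpace.single 3 1] * Ω ![EuclideanSpace.single 1 1, EuclideanSpace.single 2 1] ≠ 0 := by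
  intro Ω hΩ
  change pfaffian Ω ≠ 0
  intro h0
  obtain ⟨v, hv, hw⟩ := (pfaffian_eq_zero_iff Ω).1 h0
  obtain ⟨w, hw'⟩ := hΩ v hv
  exact hw' (hw w)

/-! ### Hodge duality for alternating trilinear forms on `ℝ⁴` -/

/-- Coordinate expansion of a trilinear form on `ℝ⁴`:
`R(a, b, c) = ∑ᵢ ∑ⱼ ∑ₖ aᵢ bⱼ cₖ R(eᵢ, eⱼ, eₖ)`. [folklore] -/
theorem trilinear_sum_stdVec
    (R : EuclideanSpace ℝ (Fin 4) → EuclideanSpace ℝ (Fin 4) → EuclideanSpace ℝ (Fin 4) → ℝ)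
    (h1 : ∀ b c, IsLinearMap ℝ fun a => R a b c) (h2 : ∀ a c, IsLinearMap ℝ fun b => R a b c)
    (h3 : ∀ a b, IsLinearMap ℝ fun c => R a b c) (a b c : EuclideanSpace ℝ (Fin 4)) :
    R a b c = ∑ i, ∑ j, ∑ k, a i * b j * c k * R (stdVec i) (stdVec j) (stdVec k) := by
  have ex1 : ∀ a b c, R a b c = ∑ i, a i * R (stdVec i) b c := by
    intro a b c
    let L : EuclideanSpace ℝ (Fin 4) →ₗ[ℝ] ℝ := IsLinearMap.mk' _ (h1 b c)
    have hL : ∀ x, R x b c = L x := fun _ => rfl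
    conv_lhs => rw [← sum_smul_stdVec a, hL, map_sum]
    refine Finset.sum_congr rfl fun i _ => ?_
    rw [map_smul, smul_eq_mul, ← hL]
  have ex2 : ∀ a b c, R a b c = ∑ i, b i * R a (stdVec i) c := by
    intro a b c
    let L : EuclideanSpace ℝ (Fin 4) →ₗ[ℝ] ℝ := IsLinearMap.mk' _ (h2 a c)
    have hL : ∀ x, R a x c = L x := fun _ => rfl
    conv_lhs => rw [← sum_smul_stdVec b, hL, map_sum]
    refine Finset.sum_congr rfl fun i _ => ?_
    rw [map_smul, smul_eq_mul, ← hL]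
  have ex3 : ∀ a b c, R a b c = ∑ i, c i * R a b (stdVec i) := by
    intro a b c
    let L : EuclideanSpace ℝ (Fin 4) →ₗ[ℝ] ℝ := IsLinearMap.mk' _ (h3 a b)
    have hL : ∀ x, R a b x = L x := fun _ => rfl
    conv_lhs => rw [← sum_smul_stdVec c, hL, map_sum]
    refine Finset.sum_congr rfl fun i _ => ?_
    rw [map_smul, smul_eq_mul, ← hL]
  rw [ex1]
  refine Finset.sum_congr rfl fun i _ => ?_
  rw [ex2, Finset.mul_sum]
  refine Finset.sum_congr rfl fun j _ => ?_
  rw [ex3, Finset.mul_sum, Finset.mul_sum]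
  refine Finset.sum_congr rfl fun k _ => ?_
  ring

/-- **Hodge duality** for 3-forms on `ℝ⁴`: an alternating trilinear form `R` is the determinant
against its dual vector, `R(v₀, v₁, v₂) = det[r, v₀, v₁, v₂]` with
`r = (R(e₁,e₂,e₃), -R(e₀,e₂,e₃), R(e₀,e₁,e₃), -R(e₀,e₁,e₂))` (expand both sides in coordinates:
`R = ∑_{i<j<k} R(eᵢ,eⱼ,eₖ) dxᵢⱼₖ` and Laplace along the first row). [folklore] -/
theorem alternating_three_eq_det_finCons
    (R : EuclideanSpace ℝ (Fin 4) → EuclideanSpace ℝ (Fin 4) → EuclideanSpace ℝ (Fin 4) → ℝ)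
    (h1 : ∀ b c, IsLinearMap ℝ fun a => R a b c) (h2 : ∀ a c, IsLinearMap ℝ fun b => R a b c)
    (h3 : ∀ a b, IsLinearMap ℝ fun c => R a b c) (h12 : ∀ a b c, R b a c = - R a b c)
    (h23 : ∀ a b c, R a c b = - R a b c) (v : Fin 3 → EuclideanSpace ℝ (Fin 4)) :
    R (v 0) (v 1) (v 2) =
      (Matrix.of fun i j =>
        (Fin.cons (WithLp.toLp 2 ![R (stdVec 1) (stdVec 2) (stdVec 3),
          -R (stdVec 0) (stdVec 2) (stdVec 3), R (stdVec 0) (stdVec 1) (stdVec 3),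
          -R (stdVec 0) (stdVec 1) (stdVec 2)]) v : Fin 4 → EuclideanSpace ℝ (Fin 4)) i j).det := by
  -- alternation kills repeated arguments
  have z12 : ∀ a c, R a a c = 0 := fun a c => by have := h12 a a c; linarith
  have z23 : ∀ a b, R a b b = 0 := fun a b => by have := h23 a b b; linarith
  rw [trilinear_sum_stdVec R h1 h2 h3, matrix_det_fin_four]
  -- the 64 coordinate terms, sorted into the 4 increasing coefficients by adjacent swaps
  simp only [Fin.sum_univ_four, z12, z23, h12 (stdVec 0) (stdVec 1), h12 (stdVec 0) (stdVec 2),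
    h12 (stdVec 0) (stdVec 3), h12 (stdVec 1) (stdVec 2), h12 (stdVec 1) (stdVec 3),
    h12 (stdVec 2) (stdVec 3), fun a => h23 a (stdVec 0) (stdVec 1),
    fun a => h23 a (stdVec 0) (stdVec 2), fun a => h23 a (stdVec 0) (stdVec 3),
    fun a => h23 a (stdVec 1) (stdVec 2), fun a => h23 a (stdVec 1) (stdVec 3),
    fun a => h23 a (stdVec 2) (stdVec 3), mul_zero, mul_neg, neg_neg, add_zero, zero_add]
  have e1 : ∀ (x : EuclideanSpace ℝ (Fin 4)),
      (Fin.cons x v : Fin 4 → EuclideanSpace ℝ (Fin 4)) 1 = v 0 := fun _ => rfl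
  have e2 : ∀ (x : EuclideanSpace ℝ (Fin 4)),
      (Fin.cons x v : Fin 4 → EuclideanSpace ℝ (Fin 4)) 2 = v 1 := fun _ => rfl
  have e3 : ∀ (x : EuclideanSpace ℝ (Fin 4)),
      (Fin.cons x v : Fin 4 → EuclideanSpace ℝ (Fin 4)) 3 = v 2 := fun _ => rfl
  simp only [Matrix.of_apply, Fin.cons_zero, e1, e2, e3, PiLp.toLp_apply, Matrix.cons_val]
  ring

/-! ### Determinants of frames `(x, v₀, v₁, v₂)` -/

/-- Laplace expansion of `det[x, v₀, v₁, v₂]` along the first row: the determinant is linear in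
`x`, with coefficients the `3 × 3` minors of `v`. [folklore] -/
theorem det_finCons_eq_sum_four (x : EuclideanSpace ℝ (Fin 4))
    (v : Fin 3 → EuclideanSpace ℝ (Fin 4)) :
    (Matrix.of fun i j => (Fin.cons x v : Fin 4 → EuclideanSpace ℝ (Fin 4)) i j).det =
      ∑ j : Fin 4, (-1) ^ (j : ℕ) * x j * (Matrix.of fun i k => v i (j.succAbove k)).det := by
  rw [Matrix.det_succ_row_zero]
  refine Finset.sum_congr rfl fun j _ => ?_
  have hsub : (Matrix.of fun i j =>
      (Fin.cons x v : Fin 4 → EuclideanSpace ℝ (Fin 4)) i j).submatrix Fin.succ j.succAbove =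
        Matrix.of fun i k => v i (j.succAbove k) := by
    ext i k
    simp only [Matrix.submatrix_apply, Matrix.of_apply, Fin.cons_succ]
  rw [hsub]
  simp only [Matrix.of_apply, Fin.cons_zero]

/-- The frame matrix applied to the coordinates of `u` lists the inner products of the frame
vectors with `u`. [folklore] -/
theorem mulVec_finCons_eq_inner (x u : EuclideanSpace ℝ (Fin 4))
    (v : Fin 3 → EuclideanSpace ℝ (Fin 4)) (i : Fin 4) :
    ((Matrix.of fun i j => (Fin.cons x v : Fin 4 → EuclideanSpace ℝ (Fin 4)) i j).mulVec
      (WithLp.ofLp u)) i = ⟪(Fin.cons x v : Fin 4 → EuclideanSpace ℝ (Fin 4)) i, u⟫ := by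
  rw [EuclideanSpace.inner_eq_star_dotProduct, Matrix.mulVec, dotProduct_comm]
  simp only [star_trivial]
  rfl

/-- If `x, v₀, v₁, v₂` are all orthogonal to a non-zero vector `u`, then `det[x, v₀, v₁, v₂] = 0`
(the frame matrix kills the coordinate vector of `u`). [folklore] -/
theorem det_finCons_eq_zero_of_inner_eq_zero (x u : EuclideanSpace ℝ (Fin 4)) (hu : u ≠ 0)
    (v : Fin 3 → EuclideanSpace ℝ (Fin 4)) (hx : ⟪x, u⟫ = 0) (hv : ∀ i, ⟪v i, u⟫ = 0) :
    (Matrix.of fun i j => (Fin.cons x v : Fin 4 → EuclideanSpace ℝ (Fin 4)) i j).det = 0 := by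
  refine Matrix.exists_mulVec_eq_zero_iff.1 ⟨WithLp.ofLp u, ?_, ?_⟩
  · intro h
    apply hu
    simpa using congrArg (WithLp.toLp 2) h
  · ext i
    rw [mulVec_finCons_eq_inner, Pi.zero_apply]
    refine Fin.cases ?_ (fun i => ?_) i
    · simpa using hx
    · simpa using hv i

/-- An orthonormal frame `(u, f₀, f₁, f₂)` of `ℝ⁴` has `|det[u, f₀, f₁, f₂]| = 1`: its matrix `A`
satisfies `A Aᵀ = 1`. [folklore] -/
theorem abs_det_finCons_eq_one (u : EuclideanSpace ℝ (Fin 4)) (hu : ‖u‖ = 1)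
    (f : Fin 3 → EuclideanSpace ℝ (Fin 4)) (hf : Orthonormal ℝ f) (hfu : ∀ i, ⟪f i, u⟫ = 0) :
    |(Matrix.of fun i j => (Fin.cons u f : Fin 4 → EuclideanSpace ℝ (Fin 4)) i j).det| = 1 := by
  set A := Matrix.of fun i j => (Fin.cons u f : Fin 4 → EuclideanSpace ℝ (Fin 4)) i j with hA
  have hw : ∀ i j : Fin 4, ⟪(Fin.cons u f : Fin 4 → EuclideanSpace ℝ (Fin 4)) i,
      (Fin.cons u f : Fin 4 → EuclideanSpace ℝ (Fin 4)) j⟫ = if i = j then (1 : ℝ) else 0 := by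
    intro i j
    refine Fin.cases ?_ (fun i => ?_) i <;> refine Fin.cases ?_ (fun j => ?_) j
    · simp only [Fin.cons_zero, if_true]
      rw [real_inner_self_eq_norm_sq, hu, one_pow]
    · simp only [Fin.cons_zero, Fin.cons_succ, (Fin.succ_ne_zero j).symm, if_false]
      rw [real_inner_comm, hfu j]
    · simp only [Fin.cons_zero, Fin.cons_succ, Fin.succ_ne_zero, if_false]
      rw [hfu i]
    · simp only [Fin.cons_succ, Fin.succ_inj]
      exact orthonormal_iff_ite.1 hf i j
  have hAAt : A * A.transpose = 1 := by
    ext i j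
    have hij := hw i j
    rw [← mulVec_finCons_eq_inner] at hij
    rw [Matrix.one_apply, ← hij, Matrix.mul_apply, Matrix.mulVec, dotProduct]
    rfl
  have hsq : A.det * A.det = 1 := by
    have h := congrArg Matrix.det hAAt
    rwa [Matrix.det_mul, Matrix.det_transpose, Matrix.det_one] at h
  rcases mul_self_eq_one_iff.1 hsq with h | h
  · rw [h, abs_one]
  · rw [h, abs_neg, abs_one]

/-! ### Alternating trilinear forms restricted to a hyperplane -/

/-- **Proportionality on `u^⊥` with a bound**: an alternating trilinear form `R` on `ℝ⁴`,
restricted to triples orthogonal to a unit vector `u`, is a multiple `κ` of the frame determinant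
`det[u, ·, ·, ·]`, and `|κ| ≤ δ` whenever `|R(a,b,c)| ≤ δ ‖a‖ ‖b‖ ‖c‖`.  With the Hodge dual
vector `r` of `R` (`alternating_three_eq_det_finCons`) one has `κ = ⟪r, u⟫`: the rows of
`[r - κ u, v₀, v₁, v₂]` are orthogonal to `u`, so its determinant vanishes; the bound is read off
on an orthonormal frame of `u^⊥`, whose completed frame matrix has determinant `±1`. [folklore] -/
theorem alternating_three_restrict_orthogonal_four :
    ∀ (R : EuclideanSpace ℝ (Fin 4) → EuclideanSpace ℝ (Fin 4) → EuclideanSpace ℝ (Fin 4) → ℝ), (∀ b c, IsLinearMap ℝ fun a => R a b c) → (∀ a c, IsLinearMap ℝ fun b => R a b c) → (∀ a b, IsLinearMap ℝ fun c => R a b c) → (∀ a b c, R b a c = - R a b c) → (∀ a b c, R a c b = - R a b c) → ∀ u : EuclideanSpace ℝ (Fin 4), ‖u‖ = 1 → ∃ κ : ℝ, (∀ v : Fin 3 → EuclideanSpace ℝ (Fin 4), (∀ i, ⟪v i, u⟫ = 0) → R (v 0) (v 1) (v 2) = κ * (Matrix.of fun i j => (Fin.cons u v : Fin 4 → EuclideanSpace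 ℝ (Fin 4)) i j).det) ∧ ∀ δ : ℝ, (∀ a b c, |R a b c| ≤ δ * ‖a‖ * ‖b‖ * ‖c‖) → |κ| ≤ δ := by
  intro R h1 h2 h3 h12 h23 u hu
  have hu0 : u ≠ 0 := by
    intro h
    rw [h, norm_zero] at hu
    exact zero_ne_one hu
  -- the Hodge dual vector `r` of `R`
  obtain ⟨r, hr⟩ : ∃ r : EuclideanSpace ℝ (Fin 4), ∀ v : Fin 3 → EuclideanSpace ℝ (Fin 4),
      R (v 0) (v 1) (v 2) =
        (Matrix.of fun i j => (Fin.cons r v : Fin 4 → EuclideanSpace ℝ (Fin 4)) i j).det :=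
    ⟨_, alternating_three_eq_det_finCons R h1 h2 h3 h12 h23⟩
  -- proportionality with `κ = ⟪r, u⟫`
  have main : ∀ v : Fin 3 → EuclideanSpace ℝ (Fin 4), (∀ i, ⟪v i, u⟫ = 0) →
      R (v 0) (v 1) (v 2) =
        ⟪r, u⟫ * (Matrix.of fun i j => (Fin.cons u v : Fin 4 → EuclideanSpace ℝ (Fin 4)) i j).det := by
    intro v hv
    have hp : ⟪r - ⟪r, u⟫ • u, u⟫ = 0 := by
      rw [inner_sub_left, real_inner_smul_left, real_inner_self_eq_norm_sq, hu]
      ring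
    have h0 := det_finCons_eq_zero_of_inner_eq_zero (r - ⟪r, u⟫ • u) u hu0 v hp hv
    rw [det_finCons_eq_sum_four] at h0
    rw [hr, det_finCons_eq_sum_four r v, det_finCons_eq_sum_four u v, Finset.mul_sum,
      ← sub_eq_zero, ← Finset.sum_sub_distrib]
    refine Eq.trans (Finset.sum_congr rfl fun j _ => ?_) h0
    simp only [PiLp.sub_apply, PiLp.smul_apply, smul_eq_mul]
    ring
  refine ⟨⟪r, u⟫, main, fun δ hδ => ?_⟩
  -- an orthonormal frame `f` of `u^⊥`
  haveI : Fact (Module.finrank ℝ (EuclideanSpace ℝ (Fin 4)) = 3 + 1) :=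
    ⟨finrank_euclideanSpace_fin⟩
  let b := OrthonormalBasis.fromOrthogonalSpanSingleton (𝕜 := ℝ) 3 hu0
  let f : Fin 3 → EuclideanSpace ℝ (Fin 4) := fun i => (b i : EuclideanSpace ℝ (Fin 4))
  have hfu : ∀ i, ⟪f i, u⟫ = 0 := fun i =>
    Submodule.mem_orthogonal_singleton_iff_inner_left.1 (b i).2
  have hf : Orthonormal ℝ f := b.orthonormal.comp_linearIsometry (Submodule.subtypeₗᵢ _)
  have hR := main f hfu
  have hb := hδ (f 0) (f 1) (f 2)
  rw [hR, hf.1 0, hf.1 1, hf.1 2, mul_one, mul_one, mul_one, abs_mul,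
    abs_det_finCons_eq_one u hu f hf hfu, mul_one] at hb
  exact hb

end Literature.Geometry.Symplectic

end
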